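import Literature.LinearAlgebra.Alternating.DarbouxBasis
import HarnessLib

/-!
# Symplectic involutions of multiplier `+1` are `Sp`-conjugate to `diag(ε) ⊕ diag(ε)`
# (Goresky–Tai 2017, Proposition 44 — Hua / Dieudonné / Huppert)

Goresky–Tai, *Real structures on ordinary abelian varieties*, arXiv:1701.07742, Appendix §19.1, print (verbatim):

> «If `e_1, e_2, ⋯, e_{2n}` denotes the standard basis of `R^{2n}` and if `1 ≤ r ≤ n` set
> `τ_r(e_i) = e_i` if `1 ≤ i ≤ 2r`, `−e_i` if `2r + 1 ≤ i ≤ 2n`.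
> **Proposition 44.** ([Hua, Dieudonne, Huppert]) Let `R` be an integral domain that contains `½`.  Let
> `τ : R^{2n} → R^{2n}` be an `R`-linear mapping such that `τ² = I`, and suppose that conjugation by `τ` preserves
> `Sp_{2n}(R) ⊂ GL_{2n}(R)`.  Then `τ ∈ GSp_{2n}(R)` and its multiplier is `±1`.  If it is `−1` then `τ` is
> `Sp_{2n}(R)`-conjugate to `τ_0`.  If its multiplier is `+1` then `τ` is `Sp_{2n}(R)`-conjugate to `τ_r` for some
> `r` with `1 ≤ r ≤ n`.»

and, for the case of multiplier `+1` (proof, verbatim): «Now suppose `c = +1` so that `𝔅(τ(x), τ(y)) = 𝔅(x, y)`.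
Let `dim(T₊) = r`.  Then `T₋` and `T₊` are orthogonal under the symplectic form, so … the restriction of the
symplectic form to each of these subspaces is non-degenerate.  In particular, `r` is even.  A symplectic basis
`{v_1, ⋯, v_{2r}}` for `T₊` and a symplectic basis `{v_{2r+1}, ⋯, v_{2n}}` for `T₋` gives a symplectic basis
`{v_1, ⋯, v_{2n}}` for `T` for which `τ` is given by equation (τ_r).»

## What is formalized (the multiplier-`+1` conjugacy statement, over a field with `2 ≠ 0`)

In Mathlib's conventions (`Matrix.J l K = (0 −1; 1 0)`, `Matrix.symplecticGroup l K = {A | A J ᵗA = J}`,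
equivalently `ᵗA J A = J`, `SymplecticGroup.mem_iff'`), for a field `K` with `(2 : K) ≠ 0` and
`τ ∈ Sp_{2l}(K)` with `τ² = 1`:

* `exists_mem_symplecticGroup_mul_eq_mul_blockDiagonal_of_mul_self_eq_one` — there are `h ∈ Sp_{2l}(K)` and
  `ε : l → {±1}` with `τ h = h · (diag ε 0; 0 diag ε)`: the columns of `h` are a symplectic basis
  `(e_j)_j, (f_j)_j` of `K^{2l}` in which `τ e_j = ε_j e_j`, `τ f_j = ε_j f_j` — this is `τ_r`, `r = #{j | ε_j = 1}`,
  up to the order of the hyperbolic pairs (we do not sort the pairs; `τ = −1`, i.e. `r = 0`, is allowed here);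
* `exists_symplecticGroup_conj_eq_blockDiagonal_of_mul_self_eq_one` — the same as `h⁻¹ τ h = (diag ε 0; 0 diag ε)`
  in the group `Matrix.symplecticGroup l K`.

The proof is the printed one: `K^{2l} = W₊ ⊕ W₋` (`W_± = ker(τ ∓ 1)`, using `2⁻¹`), `W₊ ⊥ W₋` for
`B(x, y) = ᵗx J y` (from `B(τx, τy) = B(x, y)`: `B(x, y) = −B(x, y)`), hence `B|W_±` alternating and
non-degenerate, Darboux bases of `W₊` and `W₋` (the tree's
`Literature.LinearAlgebra.Alternating.exists_symplecticBasis`, with `2·#pairs = dim`,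
`Literature.LinearAlgebra.Alternating.two_mul_card_eq_finrank`), `#ι₊ + #ι₋ = #l`, and the union of the two
bases, re-indexed by `l ⊕ l`, is the symplectic matrix `h`.

Scope / not formalized here: (i) the printed ring of coefficients is an integral domain `R ∋ ½`; the printed proof
chooses «a symplectic basis for `T₊`», which needs the projective modules `T_±` to be free with a Darboux basis —
we vendor the case of a field `K` with `2 ≠ 0`, where the tree's Darboux theorem applies
(TODO(general form): principal ideal domains containing `½`); (ii) the first assertion of the proposition
(`τ ∈ GSp` with multiplier `±1` from «conjugation by `τ` preserves `Sp`», via Schur's lemma) is not formalized —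
we assume `τ ∈ Sp_{2l}(K)` (multiplier `+1`) outright; (iii) the multiplier-`−1` half (`τ ∼ τ_0 = (−1 0; 0 1)`)
is, over `ℝ`, the tree's
`Literature.AlgebraicGeometry.ModuliOfAbelianVarieties.SiegelModuli.exists_mem_symplecticGroup_mul_eq_mul_iStar_of_mul_self_eq_one`.

## References

* [GoreskyTai2017RealStructuresOrdinary] M. Goresky, Y.-S. Tai, *Real structures on ordinary abelian varieties*,
  arXiv:1701.07742 (2017), Appendix §19 «Involutions on the symplectic group», §19.1, Proposition 44 (attributed
  there to Hua, Dieudonné, Huppert).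
-/

noncomputable section

open Matrix Module

namespace Literature.LinearAlgebra.Matrix

variable {K : Type*} [Field K] {l : Type*} [Fintype l] [DecidableEq l]

/-! ## §1 The form `B(x, y) = ᵗx J y` on `K^{l ⊕ l}` and the eigenspaces of a symplectic involution -/

section Form

/-- `B(x, y) = x ⬝ (J y)` unfolded.  [folklore] -/
private theorem formJ_apply (x y : l ⊕ l → K) :
    Matrix.toLinearMap₂' K (Matrix.J l K) x y = x ⬝ᵥ (Matrix.J l K *ᵥ y) := by
  rw [Matrix.toLinearMap₂'_apply']

omit [DecidableEq l] in
/-- `ᵗ(Ax) w = ᵗx (ᵗA w)`.  [folklore] -/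
private theorem mulVec_dotProduct_eq (A : Matrix (l ⊕ l) (l ⊕ l) K) (x w : l ⊕ l → K) :
    (A *ᵥ x) ⬝ᵥ w = x ⬝ᵥ (Aᵀ *ᵥ w) := by
  rw [dotProduct_mulVec x, vecMul_transpose]

/-- `B` is skew: `ᵗx J y = −ᵗy J x`.  [folklore] -/
private theorem formJ_swap (x y : l ⊕ l → K) : x ⬝ᵥ (Matrix.J l K *ᵥ y) = -(y ⬝ᵥ (Matrix.J l K *ᵥ x)) := by
  rw [dotProduct_comm y, mulVec_dotProduct_eq, Matrix.J_transpose, neg_mulVec, dotProduct_neg, neg_neg]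

/-- `B` is alternating (`2 ≠ 0`).  [folklore] -/
private theorem formJ_isAlt (h2 : (2 : K) ≠ 0) :
    (Matrix.toLinearMap₂' K (Matrix.J l K) : LinearMap.BilinForm K (l ⊕ l → K)).IsAlt := by
  intro x
  rw [formJ_apply]
  have h' : (2 : K) * (x ⬝ᵥ (Matrix.J l K *ᵥ x)) = 0 := by
    rw [two_mul]
    nth_rw 2 [formJ_swap]
    rw [add_neg_cancel]
  exact (mul_eq_zero.1 h').resolve_left h2

/-- `B` is non-degenerate on `K^{l ⊕ l}`: `ᵗx J y = 0` for all `y` forces `x = 0` (`J² = −1`).  [folklore] -/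
private theorem eq_zero_of_forall_formJ_eq_zero {x : l ⊕ l → K} (hx : ∀ y, x ⬝ᵥ (Matrix.J l K *ᵥ y) = 0) : x = 0 := by
  have h1 : x ᵥ* Matrix.J l K = 0 := by
    ext i
    have := hx (Pi.single i 1)
    rwa [dotProduct_mulVec, dotProduct_single, mul_one] at this
  have h2 : x ᵥ* Matrix.J l K ᵥ* Matrix.J l K = x ᵥ* (-1 : Matrix (l ⊕ l) (l ⊕ l) K) := by
    rw [vecMul_vecMul, Matrix.J_squared]
  rw [h1, zero_vecMul, vecMul_neg, vecMul_one] at h2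
  exact neg_eq_zero.1 h2.symm

variable {τ : Matrix (l ⊕ l) (l ⊕ l) K}

/-- A symplectic `τ` preserves `B`: `B(τx, τy) = B(x, y)`.  [folklore] -/
private theorem formJ_mulVec_mulVec (hτ : τ ∈ Matrix.symplecticGroup l K) (x y : l ⊕ l → K) :
    (τ *ᵥ x) ⬝ᵥ (Matrix.J l K *ᵥ (τ *ᵥ y)) = x ⬝ᵥ (Matrix.J l K *ᵥ y) := by
  rw [SymplecticGroup.mem_iff'] at hτ
  rw [mulVec_dotProduct_eq, mulVec_mulVec, mulVec_mulVec, hτ]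

/-- For an involution `τ` preserving `B`, the `±1`-eigenspaces are `B`-orthogonal (`2 ≠ 0`).  [folklore] -/
private theorem formJ_eq_zero_of_eigen (h2 : (2 : K) ≠ 0) (hτ : τ ∈ Matrix.symplecticGroup l K) {x y : l ⊕ l → K}
    (hx : τ *ᵥ x = x) (hy : τ *ᵥ y = -y) : x ⬝ᵥ (Matrix.J l K *ᵥ y) = 0 := by
  have h := formJ_mulVec_mulVec hτ x y
  rw [hx, hy, mulVec_neg, dotProduct_neg] at h
  have h' : (2 : K) * (x ⬝ᵥ (Matrix.J l K *ᵥ y)) = 0 := by rw [two_mul]; nth_rw 1 [← h]; rw [neg_add_cancel]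
  exact (mul_eq_zero.1 h').resolve_left h2

/-- The two eigenspaces `ker(τ ∓ 1)` of an involution are complementary (`2 ≠ 0`).  [folklore] -/
private theorem isCompl_eigen (h2 : (2 : K) ≠ 0) (hττ : τ * τ = 1) :
    IsCompl (LinearMap.ker (Matrix.toLin' τ - LinearMap.id)) (LinearMap.ker (Matrix.toLin' τ + LinearMap.id)) := by
  constructor
  · rw [Submodule.disjoint_def]
    intro x hx hy
    rw [LinearMap.mem_ker, LinearMap.sub_apply, LinearMap.id_apply, Matrix.toLin'_apply, sub_eq_zero] at hx
    rw [LinearMap.mem_ker, LinearMap.add_apply, LinearMap.id_apply, Matrix.toLin'_apply, hx, ← two_smul K] at hy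
    exact (smul_eq_zero.1 hy).resolve_left h2
  · rw [codisjoint_iff, eq_top_iff]
    intro x _
    have hx : x = (2 : K)⁻¹ • (x + τ *ᵥ x) + (2 : K)⁻¹ • (x - τ *ᵥ x) := by
      rw [← smul_add, add_add_sub_cancel, ← two_smul K, smul_smul, inv_mul_cancel₀ h2, one_smul]
    rw [hx]
    refine Submodule.add_mem _ (Submodule.mem_sup_left (Submodule.smul_mem _ _ ?_))
      (Submodule.mem_sup_right (Submodule.smul_mem _ _ ?_))
    · rw [LinearMap.mem_ker, LinearMap.sub_apply, LinearMap.id_apply, Matrix.toLin'_apply, mulVec_add, mulVec_mulVec,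
        hττ, one_mulVec, add_comm (τ *ᵥ x), sub_self]
    · rw [LinearMap.mem_ker, LinearMap.add_apply, LinearMap.id_apply, Matrix.toLin'_apply, mulVec_sub, mulVec_mulVec,
        hττ, one_mulVec, sub_add_sub_cancel', sub_self]

/-- Membership in the eigenspaces, unfolded.  [folklore] -/
private theorem mem_kerSub_iff (x : l ⊕ l → K) : x ∈ LinearMap.ker (Matrix.toLin' τ - LinearMap.id) ↔ τ *ᵥ x = x := by
  rw [LinearMap.mem_ker, LinearMap.sub_apply, LinearMap.id_apply, Matrix.toLin'_apply, sub_eq_zero]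

/-- Membership in the eigenspaces, unfolded.  [folklore] -/
private theorem mem_kerAdd_iff (x : l ⊕ l → K) : x ∈ LinearMap.ker (Matrix.toLin' τ + LinearMap.id) ↔ τ *ᵥ x = -x := by
  rw [LinearMap.mem_ker, LinearMap.add_apply, LinearMap.id_apply, Matrix.toLin'_apply, add_eq_zero_iff_eq_neg]

/-- `B` restricted to an eigenspace `W` of a symplectic involution is alternating and non-degenerate, provided the other
eigenspace `W′` is a `B`-orthogonal complement.  [folklore] -/
private theorem restrict_isAlt_nondegenerate (h2 : (2 : K) ≠ 0) {W W' : Submodule K (l ⊕ l → K)} (hWW' : IsCompl W W')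
    (horth : ∀ x ∈ W, ∀ y ∈ W', x ⬝ᵥ (Matrix.J l K *ᵥ y) = 0) :
    (LinearMap.BilinForm.restrict (Matrix.toLinearMap₂' K (Matrix.J l K) : LinearMap.BilinForm K (l ⊕ l → K)) W).IsAlt ∧
      (LinearMap.BilinForm.restrict (Matrix.toLinearMap₂' K (Matrix.J l K) : LinearMap.BilinForm K (l ⊕ l → K)) W).Nondegenerate := by
  have hrW : ∀ x y : W, LinearMap.BilinForm.restrict (Matrix.toLinearMap₂' K (Matrix.J l K) : LinearMap.BilinForm K (l ⊕ l → K)) W x y =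
      (x : l ⊕ l → K) ⬝ᵥ (Matrix.J l K *ᵥ y) :=
    fun x y => by rw [← formJ_apply]; rfl
  have hleft : ∀ x : W, (∀ y : W, LinearMap.BilinForm.restrict
      (Matrix.toLinearMap₂' K (Matrix.J l K) : LinearMap.BilinForm K (l ⊕ l → K)) W x y = 0) → x = 0 := by
    intro x hx
    apply Subtype.ext
    apply eq_zero_of_forall_formJ_eq_zero
    intro v
    have hv : v ∈ W ⊔ W' := by rw [hWW'.sup_eq_top]; exact Submodule.mem_top
    obtain ⟨y, hy, z, hz, rfl⟩ := Submodule.mem_sup.1 hv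
    rw [mulVec_add, dotProduct_add, horth x x.2 z hz, add_zero, ← hrW x ⟨y, hy⟩]
    exact hx ⟨y, hy⟩
  refine ⟨fun x => by rw [hrW, ← formJ_apply]; exact formJ_isAlt h2 (x : l ⊕ l → K), hleft, ?_⟩
  · intro y hy
    refine hleft y fun x => ?_
    rw [hrW, formJ_swap, ← hrW, hy x, neg_zero]

end Form

/-! ## §2 Goresky–Tai 2017 Proposition 44, multiplier `+1`: `τ` is `Sp`-conjugate to `diag(ε) ⊕ diag(ε)` -/

section Main

omit [DecidableEq l] in
/-- `(ᵗX M Y)_{ac} = ᵗ(X e_a) M (Y e_c)`.  [folklore] -/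
private theorem transpose_mul_mul_apply (X M Y : Matrix (l ⊕ l) (l ⊕ l) K) (a c : l ⊕ l) :
    (Xᵀ * M * Y) a c = (fun r => X r a) ⬝ᵥ (M *ᵥ fun r => Y r c) := by
  rw [Matrix.mul_assoc]
  simp only [mul_apply, transpose_apply, dotProduct, mulVec]

omit [DecidableEq l] in
/-- `(M Y)_{rc} = (M (Y e_c))_r`.  [folklore] -/
private theorem mul_apply_eq_mulVec (M Y : Matrix (l ⊕ l) (l ⊕ l) K) (r c : l ⊕ l) :
    (M * Y) r c = (M *ᵥ fun s => Y s c) r := by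
  simp only [mul_apply, mulVec, dotProduct]

omit [Fintype l] in
/-- The entries of `J = (0 −1; 1 0)`.  [folklore] -/
private theorem J_apply_cases (a c : l ⊕ l) :
    Matrix.J l K a c = Sum.elim (fun j => Sum.elim (fun _ => (0 : K)) (fun j' => -(if j = j' then 1 else 0)) c)
      (fun j => Sum.elim (fun j' => if j = j' then 1 else 0) (fun _ => 0) c) a := by
  rcases a with j | j <;> rcases c with j' | j' <;>
    simp [Matrix.J, fromBlocks_apply₁₁, fromBlocks_apply₁₂, fromBlocks_apply₂₁, fromBlocks_apply₂₂, Matrix.one_apply]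

/-- **Goresky–Tai 2017, Proposition 44 (the case of multiplier `+1`), matrix form.**  «Let `τ : R^{2n} → R^{2n}` be an
`R`-linear mapping such that `τ² = I` … If its multiplier is `+1` then `τ` is `Sp_{2n}(R)`-conjugate to `τ_r` for some
`r` with `1 ≤ r ≤ n`» (`τ_r = +1` on the first `2r` symplectic coordinates, `−1` on the last `2(n − r)`), here over a
FIELD `K` with `2 ≠ 0` (the printed hypothesis is an integral domain containing `½`; the proof uses bases of the
eigenspaces, i.e. a field or a ring over which those projective modules are free): for `τ ∈ Sp_{2l}(K)` with `τ² = 1`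
there is `h ∈ Sp_{2l}(K)` and a sign pattern `ε : l → {±1}` with `τh = h·(diag ε 0; 0 diag ε)` — the matrix of `τ`
in the symplectic basis `h` is `+1` on the pairs `(e_j, f_j)` with `ε_j = 1` and `−1` on the others (`τ_r` up to the
order of the pairs, `r = #{ε = 1}`; GT's `1 ≤ r` excludes `τ = −1`, which is allowed here with `ε ≡ −1`).  Proof as
printed: `T = T₋ ⊕ T₊` (eigenspaces, `2⁻¹ ∈ K`), «`T₋` and `T₊` are orthogonal under the symplectic form … the
restriction of the symplectic form to each of these subspaces is non-degenerate … A symplectic basis for `T₊` and a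
symplectic basis for `T₋` gives a symplectic basis for `T`» (Darboux: the tree's `Alternating.exists_symplecticBasis`).
[cite: GoreskyTai2017RealStructuresOrdinary, Appendix §19.1 Proposition 44] -/
theorem exists_mem_symplecticGroup_mul_eq_mul_blockDiagonal_of_mul_self_eq_one (h2 : (2 : K) ≠ 0)
    {τ : Matrix (l ⊕ l) (l ⊕ l) K} (hτ : τ ∈ Matrix.symplecticGroup l K) (hττ : τ * τ = 1) :
    ∃ h : Matrix (l ⊕ l) (l ⊕ l) K, h ∈ Matrix.symplecticGroup l K ∧ ∃ ε : l → K, (∀ i, ε i = 1 ∨ ε i = -1) ∧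
      τ * h = h * fromBlocks (diagonal ε) 0 0 (diagonal ε) := by
  classical
  -- the eigenspaces `Wp = ker(τ − 1)`, `Wm = ker(τ + 1)`
  set Wp := LinearMap.ker (Matrix.toLin' τ - LinearMap.id) with hWp
  set Wm := LinearMap.ker (Matrix.toLin' τ + LinearMap.id) with hWm
  have hc : IsCompl Wp Wm := isCompl_eigen h2 hττ
  have horth : ∀ x ∈ Wp, ∀ y ∈ Wm, x ⬝ᵥ (Matrix.J l K *ᵥ y) = 0 := fun x hx y hy =>
    formJ_eq_zero_of_eigen h2 hτ ((mem_kerSub_iff x).1 hx) ((mem_kerAdd_iff y).1 hy)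
  have horth' : ∀ x ∈ Wm, ∀ y ∈ Wp, x ⬝ᵥ (Matrix.J l K *ᵥ y) = 0 := fun x hx y hy => by
    rw [formJ_swap, horth y hy x hx, neg_zero]
  obtain ⟨hAp, hNp⟩ := restrict_isAlt_nondegenerate h2 hc horth
  obtain ⟨hAm, hNm⟩ := restrict_isAlt_nondegenerate h2 hc.symm horth'
  -- Darboux bases of the two eigenspaces
  obtain ⟨ιp, _, _, bp, hp11, hp22, hp12, hp21⟩ := Literature.LinearAlgebra.Alternating.exists_symplecticBasis hAp hNp
  obtain ⟨ιm, _, _, bm, hm11, hm22, hm12, hm21⟩ := Literature.LinearAlgebra.Alternating.exists_symplecticBasis hAm hNm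
  have hrp : ∀ x y : Wp, LinearMap.BilinForm.restrict
      (Matrix.toLinearMap₂' K (Matrix.J l K) : LinearMap.BilinForm K (l ⊕ l → K)) Wp x y =
      (x : l ⊕ l → K) ⬝ᵥ (Matrix.J l K *ᵥ (y : l ⊕ l → K)) := fun x y => by rw [← formJ_apply]; rfl
  have hrm : ∀ x y : Wm, LinearMap.BilinForm.restrict
      (Matrix.toLinearMap₂' K (Matrix.J l K) : LinearMap.BilinForm K (l ⊕ l → K)) Wm x y =
      (x : l ⊕ l → K) ⬝ᵥ (Matrix.J l K *ᵥ (y : l ⊕ l → K)) := fun x y => by rw [← formJ_apply]; rfl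
  -- dimensions: `#ιp + #ιm = #l`
  have hcard : Fintype.card (ιp ⊕ ιm) = Fintype.card l := by
    have h1 := Literature.LinearAlgebra.Alternating.two_mul_card_eq_finrank bp
    have h1' := Literature.LinearAlgebra.Alternating.two_mul_card_eq_finrank bm
    have h3 : finrank K Wp + finrank K Wm = finrank K (l ⊕ l → K) := by
      rw [← Submodule.finrank_sup_add_finrank_inf_eq, hc.sup_eq_top, hc.inf_eq_bot, finrank_top, finrank_bot, add_zero]
    rw [finrank_fintype_fun_eq_card, Fintype.card_sum] at h3
    rw [Fintype.card_sum]
    omega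
  let σ : ιp ⊕ ιm ≃ l := Fintype.equivOfCardEq hcard
  -- the new symplectic basis: `e p`, `f p` for `p : ιp ⊕ ιm`
  let e : ιp ⊕ ιm → (l ⊕ l → K) := Sum.elim (fun i => (bp (Sum.inr i) : l ⊕ l → K)) (fun k => (bm (Sum.inr k) : l ⊕ l → K))
  let f : ιp ⊕ ιm → (l ⊕ l → K) := Sum.elim (fun i => (bp (Sum.inl i) : l ⊕ l → K)) (fun k => (bm (Sum.inl k) : l ⊕ l → K))
  let sgn : ιp ⊕ ιm → K := Sum.elim (fun _ => 1) (fun _ => -1)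
  have he_eigen : ∀ p, τ *ᵥ e p = sgn p • e p := by
    rintro (i | k)
    · simp only [e, sgn, Sum.elim_inl, one_smul]
      exact (mem_kerSub_iff _).1 (bp (Sum.inr i)).2
    · simp only [e, sgn, Sum.elim_inr, neg_one_smul]
      exact (mem_kerAdd_iff _).1 (bm (Sum.inr k)).2
  have hf_eigen : ∀ p, τ *ᵥ f p = sgn p • f p := by
    rintro (i | k)
    · simp only [f, sgn, Sum.elim_inl, one_smul]
      exact (mem_kerSub_iff _).1 (bp (Sum.inl i)).2
    · simp only [f, sgn, Sum.elim_inr, neg_one_smul]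
      exact (mem_kerAdd_iff _).1 (bm (Sum.inl k)).2
  -- Gram values
  have hee : ∀ p q, e p ⬝ᵥ (Matrix.J l K *ᵥ e q) = 0 := by
    rintro (i | k) (i' | k')
    · simp only [e, Sum.elim_inl]; rw [← hrp]; exact hp22 i i'
    · simp only [e, Sum.elim_inl, Sum.elim_inr]; exact horth _ (bp _).2 _ (bm _).2
    · simp only [e, Sum.elim_inl, Sum.elim_inr]; exact horth' _ (bm _).2 _ (bp _).2
    · simp only [e, Sum.elim_inr]; rw [← hrm]; exact hm22 k k'
  have hff : ∀ p q, f p ⬝ᵥ (Matrix.J l K *ᵥ f q) = 0 := by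
    rintro (i | k) (i' | k')
    · simp only [f, Sum.elim_inl]; rw [← hrp]; exact hp11 i i'
    · simp only [f, Sum.elim_inl, Sum.elim_inr]; exact horth _ (bp _).2 _ (bm _).2
    · simp only [f, Sum.elim_inl, Sum.elim_inr]; exact horth' _ (bm _).2 _ (bp _).2
    · simp only [f, Sum.elim_inr]; rw [← hrm]; exact hm11 k k'
  have hef : ∀ p q, e p ⬝ᵥ (Matrix.J l K *ᵥ f q) = -(if p = q then 1 else 0) := by
    rintro (i | k) (i' | k')
    · simp only [e, f, Sum.elim_inl, Sum.inl.injEq]; rw [← hrp, hp21]; split_ifs <;> simp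
    · simp only [e, f, Sum.elim_inl, Sum.elim_inr, reduceCtorEq, if_false, neg_zero]; exact horth _ (bp _).2 _ (bm _).2
    · simp only [e, f, Sum.elim_inl, Sum.elim_inr, reduceCtorEq, if_false, neg_zero]; exact horth' _ (bm _).2 _ (bp _).2
    · simp only [e, f, Sum.elim_inr, Sum.inr.injEq]; rw [← hrm, hm21]; split_ifs <;> simp
  have hfe : ∀ p q, f p ⬝ᵥ (Matrix.J l K *ᵥ e q) = if p = q then 1 else 0 := by
    intro p q
    rw [formJ_swap, hef, neg_neg]
    by_cases hpq : p = q
    · rw [if_pos hpq, if_pos hpq.symm]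
    · rw [if_neg hpq, if_neg (fun h' => hpq h'.symm)]
  -- the matrix `h` with columns `e (σ⁻¹ j)` (at `inl j`) and `f (σ⁻¹ j)` (at `inr j`)
  let col : l ⊕ l → (l ⊕ l → K) := Sum.elim (fun j => e (σ.symm j)) (fun j => f (σ.symm j))
  let h : Matrix (l ⊕ l) (l ⊕ l) K := Matrix.of fun r c => col c r
  let ε : l → K := fun j => sgn (σ.symm j)
  have hcol_eigen : ∀ c, τ *ᵥ col c = Sum.elim ε ε c • col c := by
    rintro (j | j)
    · exact he_eigen (σ.symm j)
    · exact hf_eigen (σ.symm j)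
  have hgram : ∀ a c, col a ⬝ᵥ (Matrix.J l K *ᵥ col c) = Matrix.J l K a c := by
    rintro (j | j) (j' | j') <;> rw [J_apply_cases] <;> simp only [col, Sum.elim_inl, Sum.elim_inr]
    · exact hee _ _
    · rw [hef]; exact congrArg Neg.neg (if_congr σ.symm.injective.eq_iff rfl rfl)
    · rw [hfe]; exact if_congr σ.symm.injective.eq_iff rfl rfl
    · exact hff _ _
  refine ⟨h, ?_, ε, fun j => ?_, ?_⟩
  · rw [SymplecticGroup.mem_iff']
    ext a c
    rw [transpose_mul_mul_apply]
    exact hgram a c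
  · simp only [ε, sgn]
    cases σ.symm j with
    | inl i => exact Or.inl rfl
    | inr k => exact Or.inr rfl
  · ext r c
    rw [fromBlocks_diagonal, mul_apply_eq_mulVec, mul_diagonal]
    change (τ *ᵥ col c) r = col c r * Sum.elim ε ε c
    rw [hcol_eigen, Pi.smul_apply, smul_eq_mul, mul_comm]

/-- **The same as a conjugation in the group `Sp_{2l}(K)`**: `h⁻¹τh = (diag ε 0; 0 diag ε)`.
[cite: GoreskyTai2017RealStructuresOrdinary, Appendix §19.1 Proposition 44] -/
theorem exists_symplecticGroup_conj_eq_blockDiagonal_of_mul_self_eq_one (h2 : (2 : K) ≠ 0)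
    (τ : Matrix.symplecticGroup l K) (hττ : τ * τ = 1) :
    ∃ h : Matrix.symplecticGroup l K, ∃ ε : l → K, (∀ i, ε i = 1 ∨ ε i = -1) ∧
      ((h⁻¹ * τ * h : Matrix.symplecticGroup l K) : Matrix (l ⊕ l) (l ⊕ l) K) =
        fromBlocks (diagonal ε) 0 0 (diagonal ε) := by
  have hττ' : (τ : Matrix (l ⊕ l) (l ⊕ l) K) * τ = 1 := by
    rw [← Submonoid.coe_mul, hττ]; rfl
  obtain ⟨h, hh, ε, hε, hτh⟩ := exists_mem_symplecticGroup_mul_eq_mul_blockDiagonal_of_mul_self_eq_one h2 τ.2 hττ'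
  refine ⟨⟨h, hh⟩, ε, hε, ?_⟩
  have hinv : (((⟨h, hh⟩ : Matrix.symplecticGroup l K)⁻¹ : Matrix.symplecticGroup l K) : Matrix (l ⊕ l) (l ⊕ l) K) * h = 1 := by
    have := congrArg (fun x : Matrix.symplecticGroup l K => (x : Matrix (l ⊕ l) (l ⊕ l) K))
      (inv_mul_cancel (⟨h, hh⟩ : Matrix.symplecticGroup l K))
    simpa only [Submonoid.coe_mul, OneMemClass.coe_one] using this
  rw [Submonoid.coe_mul, Submonoid.coe_mul, Matrix.mul_assoc]
  change _ * ((τ : Matrix (l ⊕ l) (l ⊕ l) K) * h) = _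
  rw [hτh, ← Matrix.mul_assoc, hinv, Matrix.one_mul]

end Main

end Literature.LinearAlgebra.Matrix
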